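import Literature.AlgebraicGeometry.Resolution.SeparatingUnit
import Literature.AlgebraicGeometry.Resolution.EmbeddingSameValues
import Literature.AlgebraicGeometry.Resolution.ConjugateBoundCoefficients
import Literature.AlgebraicGeometry.Resolution.GeneralizedStabilityHenselizedRational
import HarnessLib

/-!
# The finite family of embeddings: valuation rings `V ∘ θ`, the separating unit, twisted bounds

Topic: `Literature/AlgebraicGeometry/Resolution` (valued function fields). Groundwork for the
algebraization step of M. Temkin, *Inseparable local uniformization*, J. Algebra 373 (2013) =
arXiv:0804.1554v3, Thm. 3.3.1 (tree: `Temkin2013RelativeCurveSmoothFibre`), driver of the roof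
construction (`RoofDatum.lean`): the function field `L` is compared with `Ω ⊇ L` through a finite
family `Θ` of ring embeddings `θ : L → Ω` (the `F`-embeddings relative to each `k(x)`-embedding);
each `θ` induces the valuation ring `W_θ = V.comap θ` of `L`.

* `comap_valuation_le_one_iff`, `one_lt_comap_valuation_iff`, `comap_valuation_le_pow_iff` —
  dictionary between `W_θ.valuation` and `V.valuation ∘ θ` (the `< 1` entry is
  `valuation_comap_lt_one_iff` of `AffineModelLU.lean`) — PROVED;
* `comap_archimedean`, `comap_height_one` — if `(Ω, V)` has rank one then every `W_θ` is
  archimedean and of height one — PROVED;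
* `exists_separatingUnit_embeddings` — **a unit `s` at the inclusion with `|θ s| < 1` for every
  `θ ∈ Θ` inducing a different valuation ring** (`SeparatingUnit.lean`) — PROVED;
* `exists_separatingUnit_dichotomy` — **with value torsion over constants fixed by all `θ`:
  for every `θ ∈ Θ`, either `|θ y| = |y|` for all `y`, or `|θ s| < 1`**
  (`EmbeddingSameValues.lean`) — PROVED;
* `valuation_apply_coeff_minpoly_le_of_forall` — **twisted conjugate bound**: for an embedding
  `ι : L → Ω` and `w ∈ L`, `|ι(e_j(w))| ≤ rᵈ⁻ʲ` for the coefficients `e_j(w)` of the minimal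
  polynomial of `w` over `F`, once `|θ w| ≤ r` for all `θ` with `θ|_F = ι|_F` — PROVED;
* `finite_setOf_comp_eq`, `finite_setOf_exists_comp_eq` — finiteness of the families — PROVED.

All statements are [folklore]; no definitions, no named facts.

## Sources

* M. Temkin, arXiv:0804.1554v3, proof of Thm. 3.3.1, Steps 2–4 (the use).
* N. Bourbaki, *Algèbre commutative* VI §7 no. 2 (independence of valuations), through the tree.
-/

noncomputable section

open Polynomial

namespace Literature.AlgebraicGeometry.Resolution

universe u

variable {Ω : Type u} [Field Ω] (V : ValuationSubring Ω) {L : Type u} [Field L]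

/-! ### The dictionary `W_θ = V.comap θ` -/

section Dictionary

variable (θ : L →+* Ω)

/-- `W_θ.valuation y ≤ 1 ↔ |θ y| ≤ 1`. [folklore] -/
theorem comap_valuation_le_one_iff (y : L) :
    (V.comap θ).valuation y ≤ 1 ↔ V.valuation (θ y) ≤ 1 := by
  rw [ValuationSubring.valuation_le_one_iff, ValuationSubring.valuation_le_one_iff,
    ValuationSubring.mem_comap]

/-- `1 < W_θ.valuation y ↔ 1 < |θ y|`. [folklore] -/
theorem one_lt_comap_valuation_iff (y : L) :
    1 < (V.comap θ).valuation y ↔ 1 < V.valuation (θ y) := by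
  rw [← not_le, ← not_le, comap_valuation_le_one_iff]

/-- `W_θ.valuation b ≤ W_θ.valuation a ^ n ↔ |θ b| ≤ |θ a| ^ n` (`a ≠ 0`). [folklore] -/
theorem comap_valuation_le_pow_iff {a : L} (ha : a ≠ 0) (b : L) (n : ℕ) :
    (V.comap θ).valuation b ≤ (V.comap θ).valuation a ^ n ↔
      V.valuation (θ b) ≤ V.valuation (θ a) ^ n := by
  have han : a ^ n ≠ 0 := pow_ne_zero n ha
  have hθan : θ a ^ n ≠ 0 := pow_ne_zero n ((_root_.map_ne_zero θ).mpr ha)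
  have h1 : (V.comap θ).valuation b ≤ (V.comap θ).valuation a ^ n ↔
      (V.comap θ).valuation (b / a ^ n) ≤ 1 := by
    rw [map_div₀, map_pow, div_le_one₀ ((Valuation.pos_iff _).mpr han |>.trans_eq (map_pow _ _ _))]
  have h2 : V.valuation (θ b) ≤ V.valuation (θ a) ^ n ↔ V.valuation (θ (b / a ^ n)) ≤ 1 := by
    rw [map_div₀, map_pow, map_div₀, map_pow,
      div_le_one₀ ((Valuation.pos_iff _).mpr ((_root_.map_ne_zero θ).mpr ha) |> fun h =>
        pow_pos h n)]
  rw [h1, h2, comap_valuation_le_one_iff]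

end Dictionary

/-! ### Rank one: archimedean and height one -/

section RankOne

variable (θ : L →+* Ω)

/-- **`W_θ` is archimedean** (multiplicative form) when `(Ω, V)` has rank one. [folklore] -/
theorem comap_archimedean (hΩ : IsRankOneValued V (⊤ : Subfield Ω)) (x y : L)
    (hx : (V.comap θ).valuation x < 1) : ∃ N : ℕ, (V.comap θ).valuation (x ^ N * y) < 1 := by
  have hA : ∀ a b : Ω, 1 < V.valuation a → ∃ n : ℕ, V.valuation b ≤ V.valuation a ^ n :=
    fun a b ha => hΩ.2 a (Subfield.mem_top a) b (Subfield.mem_top b) ha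
  obtain ⟨N, hN⟩ := archimedean_mul_of_forall_le_pow V hA (θ x) (θ y)
    ((valuation_comap_lt_one_iff V θ x).mp hx)
  refine ⟨N, ?_⟩
  rw [valuation_comap_lt_one_iff, map_mul, map_pow]
  exact hN

/-- **`W_θ` has height one** when `(Ω, V)` has rank one and `W_θ` is non-trivial: every valuation
subring containing `W_θ` is `W_θ` or `L`. [folklore] -/
theorem comap_height_one (hΩ : IsRankOneValued V (⊤ : Subfield Ω)) :
    ∀ S : ValuationSubring L, V.comap θ ≤ S → S = V.comap θ ∨ S = ⊤ := by
  intro S hS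
  by_cases hSW : S = V.comap θ
  · exact Or.inl hSW
  right
  obtain ⟨y, hyS, hyW⟩ : ∃ y ∈ S, y ∉ V.comap θ := by
    by_contra h
    push Not at h
    exact hSW (le_antisymm (fun z hz => h z hz) hS)
  have hy0 : y ≠ 0 := fun h0 => hyW (by rw [h0]; exact (V.comap θ).zero_mem)
  have hy1 : 1 < V.valuation (θ y) := by
    rw [← not_le, V.valuation_le_one_iff]
    exact fun h => hyW (ValuationSubring.mem_comap.mpr h)
  refine eq_top_iff.mpr fun z _ => ?_
  obtain ⟨n, hn⟩ := hΩ.2 (θ y) (Subfield.mem_top _) (θ z) (Subfield.mem_top _) hy1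
  have hzy : z / y ^ n ∈ V.comap θ := by
    rw [← (V.comap θ).valuation_le_one_iff, map_div₀, map_pow,
      div_le_one₀ (pow_pos ((Valuation.pos_iff _).mpr hy0) n)]
    exact (comap_valuation_le_pow_iff V θ hy0 z n).mpr hn
  have : z = z / y ^ n * y ^ n := by rw [div_mul_cancel₀ _ (pow_ne_zero n hy0)]
  rw [this]
  exact S.toSubring.mul_mem (hS hzy) (S.toSubring.pow_mem hyS n)

/-- Non-triviality of `W_θ` from an element of value `> 1`. [folklore] -/
theorem exists_one_lt_comap_valuation {t : L} (ht : 1 < V.valuation (θ t)) :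
    ∃ t : L, 1 < (V.comap θ).valuation t :=
  ⟨t, (one_lt_comap_valuation_iff V θ t).mpr ht⟩

end RankOne

/-! ### The separating unit for a finite family of embeddings -/

section Separating

variable [Algebra L Ω]

/-- **The separating unit.** `(Ω, V)` of rank one, `Θ` a finite family of embeddings
`θ : L → Ω`, each moving some element to value `> 1` (non-triviality; e.g. `θ` fixes a constant
of value `> 1`), and the inclusion non-trivial too. Then there is `s ∈ L` with `|s|_V = 1` and
`|θ s|_V < 1` for every `θ ∈ Θ` with `V.comap θ ≠ V.comap (L ↪ Ω)`. [folklore] -/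
theorem exists_separatingUnit_embeddings (hΩ : IsRankOneValued V (⊤ : Subfield Ω))
    (h₀ : ∃ t : L, 1 < V.valuation (algebraMap L Ω t)) (Θ : Finset (L →+* Ω))
    (hΘ : ∀ θ ∈ Θ, ∃ t : L, 1 < V.valuation (θ t)) :
    ∃ s : L, V.valuation (algebraMap L Ω s) = 1 ∧
      ∀ θ ∈ Θ, V.comap θ ≠ V.comap (algebraMap L Ω) → V.valuation (θ s) < 1 := by
  classical
  set W₀ : ValuationSubring L := V.comap (algebraMap L Ω) with hW₀
  set 𝒲 : Finset (ValuationSubring L) := (Θ.image fun θ => V.comap θ).erase W₀ with h𝒲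
  have hW₀nt : ∃ t : L, 1 < W₀.valuation t := exists_one_lt_comap_valuation V (algebraMap L Ω) h₀.choose_spec
  have hmax₀ := comap_height_one V (algebraMap L Ω) hΩ
  have hinc : ∀ W ∈ 𝒲, ¬W₀ ≤ W ∧ ¬W ≤ W₀ := by
    intro W hW
    obtain ⟨hne, hW'⟩ := Finset.mem_erase.mp hW
    obtain ⟨θ, hθ, rfl⟩ := Finset.mem_image.mp hW'
    obtain ⟨t, ht⟩ := hΘ θ hθ
    exact not_le_and_not_le_of_height_one hmax₀ (comap_height_one V θ hΩ) hW₀nt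
      (exists_one_lt_comap_valuation V θ ht) hne
  have harch : ∀ W ∈ 𝒲, ∀ x y : L, W.valuation x < 1 → ∃ N : ℕ, W.valuation (x ^ N * y) < 1 := by
    intro W hW x y hx
    obtain ⟨-, hW'⟩ := Finset.mem_erase.mp hW
    obtain ⟨θ, -, rfl⟩ := Finset.mem_image.mp hW'
    exact comap_archimedean V θ hΩ x y hx
  obtain ⟨s, hs₀, hs⟩ := exists_valuation_eq_one_and_forall_lt_one W₀ hW₀nt 𝒲 hinc harch
  refine ⟨s, ?_, fun θ hθ hne => ?_⟩
  · -- `W₀.valuation s = 1 ⇒ |s|_V = 1`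
    have h1 : (V.comap (algebraMap L Ω)).valuation s ≤ 1 := hs₀.le
    have h2 : ¬(V.comap (algebraMap L Ω)).valuation s < 1 := fun h => (ne_of_lt h) hs₀
    rw [comap_valuation_le_one_iff] at h1
    rw [valuation_comap_lt_one_iff] at h2
    exact le_antisymm h1 (not_lt.mp h2)
  · have hW : V.comap θ ∈ 𝒲 :=
      Finset.mem_erase.mpr ⟨hne, Finset.mem_image.mpr ⟨θ, hθ, rfl⟩⟩
    exact (valuation_comap_lt_one_iff V θ s).mp (hs _ hW)

/-- **The dichotomy.** In the situation of `exists_separatingUnit_embeddings`, suppose moreover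
that every `θ ∈ Θ` fixes the constants `k → L → Ω` and that the values of `L` are torsion over
those of `k` (`IsValueTorsionOver`). Then there is `s ∈ L`, `|s|_V = 1`, such that for every
`θ ∈ Θ`: either `|θ y|_V = |y|_V` for ALL `y ∈ L`, or `|θ s|_V < 1`. [folklore] -/
theorem exists_separatingUnit_dichotomy {k : Type*} [Field k] [Algebra k L] [Algebra k Ω]
    [IsScalarTower k L Ω] (hΩ : IsRankOneValued V (⊤ : Subfield Ω))
    (h₀ : ∃ t : L, 1 < V.valuation (algebraMap L Ω t)) (Θ : Finset (L →+* Ω))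
    (hΘ : ∀ θ ∈ Θ, ∃ t : L, 1 < V.valuation (θ t))
    (hfix : ∀ θ ∈ Θ, ∀ c : k, θ (algebraMap k L c) = algebraMap k Ω c)
    (htors : IsValueTorsionOver V (algebraMap k Ω).fieldRange (algebraMap L Ω).fieldRange) :
    ∃ s : L, V.valuation (algebraMap L Ω s) = 1 ∧
      ∀ θ ∈ Θ, (∀ y : L, V.valuation (θ y) = V.valuation (algebraMap L Ω y)) ∨
        V.valuation (θ s) < 1 := by
  obtain ⟨s, hs1, hs⟩ := exists_separatingUnit_embeddings V hΩ h₀ Θ hΘ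
  refine ⟨s, hs1, fun θ hθ => ?_⟩
  by_cases hring : V.comap θ = V.comap (algebraMap L Ω)
  · exact Or.inl (valuation_apply_eq_of_comap_eq_of_isValueTorsionOver V θ hring (hfix θ hθ) htors)
  · exact Or.inr (hs θ hθ hring)

end Separating

/-! ### The twisted conjugate bound -/

section Twisted

variable [IsAlgClosed Ω] {F : Type*} [Field F] [Algebra F L] [Algebra.IsAlgebraic F L]

/-- **Twisted conjugate bound.** Let `ι : L → Ω` be a ring embedding and `w ∈ L`. If
`|θ w|_V ≤ r` for every embedding `θ : L → Ω` agreeing with `ι` on `F`, then the coefficient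
`e_i(w)` of the minimal polynomial of `w` over `F` satisfies `|ι (e_i(w))|_V ≤ r^(d − i)`,
`d` the degree. (The `F`-algebra structure on `Ω` through `ι`, then
`valuation_coeff_minpoly_le_of_forall_algHom`.) [folklore] -/
theorem valuation_apply_coeff_minpoly_le_of_forall (ι : L →+* Ω) (w : L) {r : V.ValueGroup}
    (h : ∀ θ : L →+* Ω, θ.comp (algebraMap F L) = ι.comp (algebraMap F L) → V.valuation (θ w) ≤ r)
    (i : ℕ) :
    V.valuation (ι (algebraMap F L ((minpoly F w).coeff i))) ≤ r ^ ((minpoly F w).natDegree - i) := by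
  letI : Algebra F Ω := (ι.comp (algebraMap F L)).toAlgebra
  have hσ : ∀ σ : L →ₐ[F] Ω, V.valuation (σ w) ≤ r := fun σ =>
    h σ.toRingHom (by
      ext c
      exact σ.commutes c)
  have hle := valuation_coeff_minpoly_le_of_forall_algHom V w hσ i
  exact hle

/-- **Twisted integrality.** If `θ w ∈ O_V` for all `θ` agreeing with `ι` on `F`, then
`ι (e_i(w)) ∈ O_V` for all `i`. [folklore] -/
theorem apply_coeff_minpoly_mem_of_forall (ι : L →+* Ω) (w : L)
    (h : ∀ θ : L →+* Ω, θ.comp (algebraMap F L) = ι.comp (algebraMap F L) → θ w ∈ V) (i : ℕ) :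
    ι (algebraMap F L ((minpoly F w).coeff i)) ∈ V := by
  rw [← V.valuation_le_one_iff]
  have hle := valuation_apply_coeff_minpoly_le_of_forall V ι w (r := 1)
    (fun θ hθ => (V.valuation_le_one_iff _).mpr (h θ hθ)) i
  rwa [one_pow] at hle

end Twisted

/-! ### Finiteness of the families -/

section Finiteness

variable {F : Type*} [Field F] [Algebra F L] [FiniteDimensional F L]

/-- The embeddings `θ : L → Ω` with prescribed restriction `φ` to `F` form a finite set (they
are the `F`-algebra maps for the `F`-structure `φ` on `Ω`). [folklore] -/
theorem finite_setOf_comp_eq (φ : F →+* Ω) :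
    Set.Finite {θ : L →+* Ω | θ.comp (algebraMap F L) = φ} := by
  letI : Algebra F Ω := φ.toAlgebra
  classical
  let g : (L →ₐ[F] Ω) → (L →+* Ω) := fun σ => σ.toRingHom
  refine (Set.finite_range g).subset ?_
  intro θ hθ
  refine ⟨⟨θ, fun c => ?_⟩, rfl⟩
  have := congrArg (fun ψ : F →+* Ω => ψ c) hθ
  simp only [RingHom.coe_comp, Function.comp_apply] at this
  rw [RingHom.algebraMap_toAlgebra]
  exact this

/-- The embeddings agreeing on `F` with SOME member of a finite set of embeddings form a finite
set. [folklore] -/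
theorem finite_setOf_exists_comp_eq {I : Set (L →+* Ω)} (hI : I.Finite) :
    Set.Finite {θ : L →+* Ω | ∃ ι ∈ I, θ.comp (algebraMap F L) = ι.comp (algebraMap F L)} := by
  have : {θ : L →+* Ω | ∃ ι ∈ I, θ.comp (algebraMap F L) = ι.comp (algebraMap F L)} =
      ⋃ ι ∈ I, {θ : L →+* Ω | θ.comp (algebraMap F L) = ι.comp (algebraMap F L)} := by
    ext θ
    simp
  rw [this]
  exact hI.biUnion fun ι _ => finite_setOf_comp_eq (ι.comp (algebraMap F L))

end Finiteness

end Literature.AlgebraicGeometry.Resolution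

end
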